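import Summits.MatrixMultiplication.OmegaCensus.SmallFormats.RestrictionFlatteningCaps
import Mathlib.LinearAlgebra.Matrix.NonsingularInverse
import HarnessLib

/-!
# ω-census family (a): the SATURATED INVERTIBLE POINT ('frame') law for `⟨m,m,n⟩`

Cell `pub-omega` (unit `pub-omega-tensor-g23`), topic `Summits/MatrixMultiplication/OmegaCensus` (sub-folder
`SmallFormats`). Framing (verbatim): lottery ticket; floor = certified bounds/negative ranges. HONEST FRAMING: an
elementary structural lemma — the EQUALITY CASE of the invertible-point restriction cap of
`RestrictionFlatteningCaps` (`mul_le_card_of_mem_of_isUnit`: the terms not vanishing at an invertible `X₀` number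
at least `m·n`) — written out because the census' structured searches for `𝔽₃` `⟨2,2,n⟩` at `r = 3n + 2`
(engines E1/E2/E3, tensor gens 20–23) meet it in 1 092 of the 1 148 cap-feasible X-marginal orbits of `⟨2,2,6⟩`
and it is the soundness statement behind the 'frame / footprint' filter of tensor gen 23. Not a rank bound,
nothing on `ω`.

**Setting.** `β` a bilinear computation of `X ↦ XY` (`X ∈ k^{m×m}`, `Y ∈ k^{m×n}`, outputs `W_i ∈ k^{m×n}`),
`X₀` invertible, `O` = the set of indices with `f_i(X₀) ≠ 0` (the 'off' terms; the others, `Z = Oᶜ`, vanish at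
`X₀`). Always `{W_i}_{i∈O}` spans `k^{m×n}` (`top_le_span_w_off`). If the cap is ATTAINED, `|O| = m·n`, then:
* (frame) `{W_i}_{i∈O}` is a basis of `k^{m×n}` and `f_i(X₀)·g_i(X₀⁻¹ W_j) = δ_{ij}` for `i, j ∈ O`
  (`linearIndependent_w_off`, `frame_coeff`): the off-terms are a complete system of rank-one idempotents twisted
  by `X₀`;
* (output footprint) for `j ∈ O` and EVERY `X`:
  `X·X₀⁻¹·W_j − (f_j(X)/f_j(X₀))·W_j = Σ_{i∉O} f_i(X) g_i(X₀⁻¹W_j) · W_i` (`footprint_w_eq`), so it lies in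
  `span{W_i : i ∉ O, f_i(X) ≠ 0}` (`footprint_w_mem_span`), a space of dimension `≤ |ι| − m·n`;
* (form footprint) dually `g_j(X₀⁻¹ X ·) − (f_j(X)/f_j(X₀))·g_j = Σ_{i∉O} g_j(X₀⁻¹ W_i) f_i(X) · g_i`
  (`footprint_g_eq`, `footprint_g_mem_span`).
Sanity (outside Lean, tensor g23 `check_law224.py` / `control224_ip.py`): the tree's 14-term `⟨2,2,4⟩` scheme
mod 3 has 8 saturated invertible points (`|Z| = 6 = r − 2n`) and satisfies all three identities at each.
-/

namespace Summit.MatrixMultiplication.OmegaCensus.SmallFormats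

open Module Matrix Literature.Computability.AlgebraicComplexity

variable {k : Type*} [Field k] {m n : ℕ} {ι : Type*} [Fintype ι]

/-- Brent's identity at `X₀` with the vanishing terms dropped: `X₀ Y = Σ_{i∈O} f_i(X₀) g_i(Y) W_i` whenever
`O ⊇ {i : f_i(X₀) ≠ 0}`. -/
theorem mul_eq_sum_off (β : BilinComp (mulBilin k m m n) ι) (X₀ : Matrix (Fin m) (Fin m) k) (O : Finset ι)
    (hO : ∀ i, i ∉ O → β.f i X₀ = 0) (Y : Matrix (Fin m) (Fin n) k) :
    X₀ * Y = ∑ i ∈ O, (β.f i X₀ * β.g i Y) • β.w i := by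
  classical
  have h := β.map_eq_sum X₀ Y
  rw [mulBilin_apply] at h
  rw [h, ← Finset.sum_subset (Finset.subset_univ O)]
  intro i _ hi
  rw [hO i hi, zero_mul, zero_smul]

/-- **Spanning.** At an invertible `X₀` the outputs of the terms with `f_i(X₀) ≠ 0` span `k^{m×n}`
(`Y' = X₀ (X₀⁻¹ Y')`). No saturation hypothesis. -/
theorem top_le_span_w_off (β : BilinComp (mulBilin k m m n) ι) (X₀ : Matrix (Fin m) (Fin m) k)
    (hX₀ : IsUnit X₀.det) (O : Finset ι) (hO : ∀ i, i ∉ O → β.f i X₀ = 0) :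
    ⊤ ≤ Submodule.span k (Set.range fun i : O => β.w i) := by
  intro Y' _
  have h := mul_eq_sum_off β X₀ O hO (X₀⁻¹ * Y')
  rw [← Matrix.mul_assoc, Matrix.mul_nonsing_inv X₀ hX₀, Matrix.one_mul] at h
  rw [h]
  refine Submodule.sum_mem _ fun i hi => Submodule.smul_mem _ _ (Submodule.subset_span ⟨⟨i, hi⟩, rfl⟩)

/-- **Frame, part 1.** If the cap is attained (`|O| = m·n`), the outputs `{W_i}_{i∈O}` are linearly independent,
hence a basis of `k^{m×n}`. -/
theorem linearIndependent_w_off (β : BilinComp (mulBilin k m m n) ι) (X₀ : Matrix (Fin m) (Fin m) k)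
    (hX₀ : IsUnit X₀.det) (O : Finset ι) (hO : ∀ i, i ∉ O → β.f i X₀ = 0) (hcard : O.card = m * n) :
    LinearIndependent k (fun i : O => β.w i) :=
  linearIndependent_of_top_le_span_of_card_eq_finrank (top_le_span_w_off β X₀ hX₀ O hO)
    (by rw [Fintype.card_coe, hcard, finrank_matrix_fin])

/-- **Frame, part 2 (dual coefficients).** With the cap attained, `f_i(X₀)·g_i(X₀⁻¹ W_j) = δ_{ij}` for
`i, j ∈ O`: up to the twist by `X₀` and the nonzero scalars `f_i(X₀)`, the forms `g_i` (`i ∈ O`) are the dual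
basis of the outputs `W_i` (`i ∈ O`). -/
theorem frame_coeff [DecidableEq ι] (β : BilinComp (mulBilin k m m n) ι) (X₀ : Matrix (Fin m) (Fin m) k)
    (hX₀ : IsUnit X₀.det) (O : Finset ι) (hO : ∀ i, i ∉ O → β.f i X₀ = 0) (hcard : O.card = m * n)
    {i j : ι} (hi : i ∈ O) (hj : j ∈ O) :
    β.f i X₀ * β.g i (X₀⁻¹ * β.w j) = if i = j then 1 else 0 := by
  have hli := linearIndependent_w_off β X₀ hX₀ O hO hcard
  -- `W_j = X₀ (X₀⁻¹ W_j) = Σ_{l∈O} f_l(X₀) g_l(X₀⁻¹ W_j) W_l`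
  have h := mul_eq_sum_off β X₀ O hO (X₀⁻¹ * β.w j)
  rw [← Matrix.mul_assoc, Matrix.mul_nonsing_inv X₀ hX₀, Matrix.one_mul] at h
  -- coefficient comparison
  set c : O → k := fun l => β.f l X₀ * β.g l (X₀⁻¹ * β.w j) - if (l : ι) = j then 1 else 0 with hc
  have hsum : ∑ l : O, c l • β.w l = 0 := by
    simp only [hc, sub_smul, Finset.sum_sub_distrib]
    rw [Finset.sum_coe_sort O (fun l => (β.f l X₀ * β.g l (X₀⁻¹ * β.w j)) • β.w l), ← h]
    rw [Finset.sum_coe_sort O (fun l => (if l = j then (1 : k) else 0) • β.w l)]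
    simp_rw [ite_smul, one_smul, zero_smul]
    rw [Finset.sum_ite_eq' O j, if_pos hj, sub_self]
  have hzero := (Fintype.linearIndependent_iff.mp hli) c hsum ⟨i, hi⟩
  rw [hc] at hzero
  exact sub_eq_zero.mp hzero

/-- **Output footprint (explicit).** With the cap attained, for `j ∈ O` and every `X`:
`X·X₀⁻¹·W_j − (f_j(X)·f_j(X₀)⁻¹)·W_j = Σ_{i∉O} (f_i(X)·g_i(X₀⁻¹ W_j))·W_i`. -/
theorem footprint_w_eq [DecidableEq ι] (β : BilinComp (mulBilin k m m n) ι) (X₀ : Matrix (Fin m) (Fin m) k)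
    (hX₀ : IsUnit X₀.det) (O : Finset ι) (hO : ∀ i, i ∉ O → β.f i X₀ = 0) (hO' : ∀ i ∈ O, β.f i X₀ ≠ 0)
    (hcard : O.card = m * n) {j : ι} (hj : j ∈ O) (X : Matrix (Fin m) (Fin m) k) :
    X * (X₀⁻¹ * β.w j) - (β.f j X * (β.f j X₀)⁻¹) • β.w j =
      ∑ i ∈ Finset.univ \ O, (β.f i X * β.g i (X₀⁻¹ * β.w j)) • β.w i := by
  have h := β.map_eq_sum X (X₀⁻¹ * β.w j)
  rw [mulBilin_apply] at h
  rw [h, ← Finset.sum_sdiff (Finset.subset_univ O)]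
  -- the `O`-part collapses to the `j`-term by `frame_coeff`
  have hcoef : ∀ i ∈ O, (β.f i X * β.g i (X₀⁻¹ * β.w j)) • β.w i =
      (if i = j then (β.f j X * (β.f j X₀)⁻¹) • β.w j else 0) := by
    intro i hi
    have hfc := frame_coeff β X₀ hX₀ O hO hcard hi hj
    by_cases hij : i = j
    · subst hij
      rw [if_pos rfl] at hfc
      rw [if_pos rfl]
      have hg : β.g i (X₀⁻¹ * β.w i) = (β.f i X₀)⁻¹ := eq_inv_of_mul_eq_one_right hfc
      rw [hg]
    · rw [if_neg hij] at hfc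
      rw [if_neg hij]
      rcases mul_eq_zero.mp hfc with h0 | h0
      · exact absurd h0 (hO' i hi)
      · rw [h0, mul_zero, zero_smul]
  have hOpart : ∑ i ∈ O, (β.f i X * β.g i (X₀⁻¹ * β.w j)) • β.w i = (β.f j X * (β.f j X₀)⁻¹) • β.w j := by
    rw [Finset.sum_congr rfl hcoef, Finset.sum_ite_eq' O j, if_pos hj]
  rw [hOpart, add_sub_cancel_right]

/-- **Output footprint (membership).** With the cap attained, for `j ∈ O` and every `X`,
`X·X₀⁻¹·W_j − (f_j(X)·f_j(X₀)⁻¹)·W_j` lies in the span of the outputs `W_i` of the terms vanishing at `X₀` but not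
at `X`. For `X` with `f_j(X) = 0` this says `X·X₀⁻¹·W_j ∈ span{W_i : f_i(X₀) = 0, f_i(X) ≠ 0}`. -/
theorem footprint_w_mem_span (β : BilinComp (mulBilin k m m n) ι) (X₀ : Matrix (Fin m) (Fin m) k)
    (hX₀ : IsUnit X₀.det) (O : Finset ι) (hO : ∀ i, i ∉ O → β.f i X₀ = 0) (hO' : ∀ i ∈ O, β.f i X₀ ≠ 0)
    (hcard : O.card = m * n) {j : ι} (hj : j ∈ O) (X : Matrix (Fin m) (Fin m) k) :
    X * (X₀⁻¹ * β.w j) - (β.f j X * (β.f j X₀)⁻¹) • β.w j ∈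
      Submodule.span k (β.w '' {i | i ∉ O ∧ β.f i X ≠ 0}) := by
  classical
  rw [footprint_w_eq β X₀ hX₀ O hO hO' hcard hj X]
  refine Submodule.sum_mem _ fun i hi => ?_
  rw [Finset.mem_sdiff] at hi
  by_cases hfi : β.f i X = 0
  · rw [hfi, zero_mul, zero_smul]; exact Submodule.zero_mem _
  · exact Submodule.smul_mem _ _ (Submodule.subset_span ⟨i, ⟨hi.2, hfi⟩, rfl⟩)

/-- **Form footprint (explicit).** With the cap attained, for `j ∈ O` and every `X`, as linear forms in `Y`:
`g_j(X₀⁻¹·X·Y) − (f_j(X)·f_j(X₀)⁻¹)·g_j(Y) = Σ_{i∉O} (g_j(X₀⁻¹ W_i)·f_i(X))·g_i(Y)`. -/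
theorem footprint_g_eq [DecidableEq ι] (β : BilinComp (mulBilin k m m n) ι) (X₀ : Matrix (Fin m) (Fin m) k)
    (hX₀ : IsUnit X₀.det) (O : Finset ι) (hO : ∀ i, i ∉ O → β.f i X₀ = 0) (hO' : ∀ i ∈ O, β.f i X₀ ≠ 0)
    (hcard : O.card = m * n) {j : ι} (hj : j ∈ O) (X : Matrix (Fin m) (Fin m) k) (Y : Matrix (Fin m) (Fin n) k) :
    β.g j (X₀⁻¹ * (X * Y)) - β.f j X * (β.f j X₀)⁻¹ * β.g j Y =
      ∑ i ∈ Finset.univ \ O, β.g j (X₀⁻¹ * β.w i) * β.f i X * β.g i Y := by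
  -- apply `g_j(X₀⁻¹ ·)` to Brent's identity `XY = Σ_i f_i(X) g_i(Y) W_i`
  have h := β.map_eq_sum X Y
  rw [mulBilin_apply] at h
  have hlin : β.g j (X₀⁻¹ * (X * Y)) = ∑ i, β.f i X * β.g i Y * β.g j (X₀⁻¹ * β.w i) := by
    rw [h, Matrix.mul_sum, map_sum]
    refine Finset.sum_congr rfl fun i _ => ?_
    rw [Matrix.mul_smul, map_smul, smul_eq_mul]
  rw [hlin, ← Finset.sum_sdiff (Finset.subset_univ O)]
  have hcoef : ∀ i ∈ O, β.f i X * β.g i Y * β.g j (X₀⁻¹ * β.w i) =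
      (if i = j then β.f j X * (β.f j X₀)⁻¹ * β.g j Y else 0) := by
    intro i hi
    have hfc := frame_coeff β X₀ hX₀ O hO hcard hj hi
    by_cases hij : i = j
    · subst hij
      rw [if_pos rfl] at hfc
      rw [if_pos rfl]
      have hg : β.g i (X₀⁻¹ * β.w i) = (β.f i X₀)⁻¹ := eq_inv_of_mul_eq_one_right hfc
      rw [hg]; ring
    · rw [if_neg (Ne.symm hij)] at hfc
      rw [if_neg hij]
      rcases mul_eq_zero.mp hfc with h0 | h0
      · exact absurd h0 (hO' j hj)
      · rw [h0, mul_zero]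
  rw [Finset.sum_congr rfl hcoef, Finset.sum_ite_eq' O j, if_pos hj]
  have : ∀ i ∈ Finset.univ \ O, β.f i X * β.g i Y * β.g j (X₀⁻¹ * β.w i) = β.g j (X₀⁻¹ * β.w i) * β.f i X * β.g i Y :=
    fun i _ => by ring
  rw [Finset.sum_congr rfl this]; ring

/-- **Form footprint (membership).** With the cap attained, for `j ∈ O` and every `X`, the linear form
`Y ↦ g_j(X₀⁻¹ X Y) − (f_j(X)·f_j(X₀)⁻¹)·g_j(Y)` lies in the span of the forms `g_i` of the terms vanishing at `X₀`
but not at `X`. -/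
theorem footprint_g_mem_span (β : BilinComp (mulBilin k m m n) ι) (X₀ : Matrix (Fin m) (Fin m) k)
    (hX₀ : IsUnit X₀.det) (O : Finset ι) (hO : ∀ i, i ∉ O → β.f i X₀ = 0) (hO' : ∀ i ∈ O, β.f i X₀ ≠ 0)
    (hcard : O.card = m * n) {j : ι} (hj : j ∈ O) (X : Matrix (Fin m) (Fin m) k) :
    (β.g j).comp (mulLeftRect (n := n) (X₀⁻¹ * X)) - (β.f j X * (β.f j X₀)⁻¹) • β.g j ∈
      Submodule.span k (β.g '' {i | i ∉ O ∧ β.f i X ≠ 0}) := by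
  classical
  have heq : (β.g j).comp (mulLeftRect (n := n) (X₀⁻¹ * X)) - (β.f j X * (β.f j X₀)⁻¹) • β.g j =
      ∑ i ∈ Finset.univ \ O, (β.g j (X₀⁻¹ * β.w i) * β.f i X) • β.g i := by
    ext Y
    rw [LinearMap.sub_apply, LinearMap.comp_apply, mulLeftRect_apply, Matrix.mul_assoc, LinearMap.smul_apply,
      smul_eq_mul, footprint_g_eq β X₀ hX₀ O hO hO' hcard hj X Y, LinearMap.coe_sum, Finset.sum_apply]
    refine Finset.sum_congr rfl fun i _ => ?_
    rw [LinearMap.smul_apply, smul_eq_mul]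
  rw [heq]
  refine Submodule.sum_mem _ fun i hi => ?_
  rw [Finset.mem_sdiff] at hi
  by_cases hfi : β.f i X = 0
  · rw [hfi, mul_zero, zero_smul]; exact Submodule.zero_mem _
  · exact Submodule.smul_mem _ _ (Submodule.subset_span ⟨i, ⟨hi.2, hfi⟩, rfl⟩)

/-- The footprint target space is small: `dim span{W_i : i ∉ O} ≤ |ι| − |O|` (`= r − m·n` at the cap). -/
theorem finrank_span_w_compl_le (β : BilinComp (mulBilin k m m n) ι) (O : Finset ι) :
    finrank k (Submodule.span k (β.w '' {i | i ∉ O})) ≤ Fintype.card ι - O.card := by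
  classical
  have hset : β.w '' {i | i ∉ O} = Set.range (fun i : (Finset.univ \ O : Finset ι) => β.w i) := by
    ext W
    constructor
    · rintro ⟨i, hi, rfl⟩
      exact ⟨⟨i, Finset.mem_sdiff.mpr ⟨Finset.mem_univ i, hi⟩⟩, rfl⟩
    · rintro ⟨⟨i, hi⟩, rfl⟩
      exact ⟨i, (Finset.mem_sdiff.mp hi).2, rfl⟩
  rw [hset]
  calc finrank k (Submodule.span k (Set.range fun i : (Finset.univ \ O : Finset ι) => β.w i))
      ≤ Fintype.card (Finset.univ \ O : Finset ι) := finrank_range_le_card _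
    _ = Fintype.card ι - O.card := by
        rw [Fintype.card_coe, Finset.card_sdiff, Finset.inter_univ, Finset.card_univ]

end Summit.MatrixMultiplication.OmegaCensus.SmallFormats
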